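import Mathlib
import Summits.ValiantsHypothesis.ValiantsHypothesis.Theorems.DetQPDetqpThesisHyperdetWitnessCalibration
import Summits.ValiantsHypothesis.ValiantsHypothesis.Theorems.DetQPDetqpThesisStubBorderFloor
import Summits.ValiantsHypothesis.ValiantsHypothesis.Theorems.DetQPDetqpThesisHyperdetCalibrationEquiv

/-!
# Crux `DetQP.DetqpThesis` (stmt-ValiantsHypothesis-0315), line `four-dimensional-determinant` —
# calibration of the REGISTERED bet C₂ (`stub_noFixedWitnessQP_high`, skeleton v3/v4): **C₂ ⇔ C**

The lead's reshaped skeleton (v3/v4, `Cruxes/DetqpThesis/Lines/four_dimensional_determinant.lean`)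
splits the crux-plan's bet C (`stub_noFixedWitnessQP`: no `H(n,m,ι)`-stable border-apolar witness
for the padded four-dimensional determinant anywhere in the window `n² + 1 ≤ m ≤ 2^{(log₂ n + c)^c}`)
into the LANDED border floor C₁ (`stub_borderFloor`: no membership, hence no witness, while
`2m < n⁴`) and the bet C₂ (`stub_noFixedWitnessQP_high`: no stable witness for `n⁴ ≤ 2m`).  Here:
`C₂ → C` (`hd_noFixedWitnessQP_of_high`, by C₁ and witness ⇒ membership `hdc_mem_of_fixedWitness`)
and `C → C₂` (`hd_noFixedWitnessQP_high_of`, since `n⁴ ≤ 2m ⇒ n² + 1 ≤ m` for `n ≥ 2`).  With lead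
c1's `hd_noFixedWitnessQP_iff_gctThesis` (`C ⇔ GCTMult.GctThesis`,
Theorems/DetQPDetqpThesisHyperdetCalibrationEquiv.lean) this makes the one open stub of the line
EXACTLY crux stmt-ValiantsHypothesis-0323 (the two-line composition is appended to this file as
`hd_noFixedWitnessQP_high_iff_gctThesis`).  Folklore bookkeeping over landed results.
-/

open MvPolynomial
open scoped BigOperators Matrix

namespace Summit.ValiantsHypothesis.ValiantsHypothesis.Theorems.DetQPDetqpThesis.HdCalibration

set_option linter.dupNamespace false

open Literature.Computability.AlgebraicComplexity
open Summit.ValiantsHypothesis.ValiantsHypothesis.Theorems.DetQPDetqpThesis (stub_borderFloor)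

/-- Window arithmetic: `n⁴ ≤ 2m` and `2 ≤ n` give `n² + 1 ≤ m`. -/
theorem sq_succ_le_of_pow_four_le {n m : ℕ} (hn : 2 ≤ n) (h : n ^ 4 ≤ 2 * m) : n ^ 2 + 1 ≤ m := by
  have hn2 : 4 ≤ n ^ 2 := by nlinarith
  have h5 : 4 * n ^ 2 ≤ n ^ 4 :=
    calc 4 * n ^ 2 ≤ n ^ 2 * n ^ 2 := Nat.mul_le_mul_right _ hn2
      _ = n ^ 4 := by ring
  linarith

/-- **C₂ → C**: no stable witness in the upper part of the window (the registered bet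
`stub_noFixedWitnessQP_high`, verbatim) implies none in the whole window — below `n⁴/2` there is
not even membership (`stub_borderFloor`, landed), and a stable witness gives membership
(`hdc_mem_of_fixedWitness`). -/
theorem hd_noFixedWitnessQP_of_high
    (hC₂ : ∀ c : ℕ, ∃ n₀ : ℕ, ∀ n ≥ n₀, ∀ (m : ℕ) [NeZero m], n ^ 4 ≤ 2 * m →
      m ≤ 2 ^ ((Nat.log 2 n + c) ^ c) →
      ∀ ι : (Fin 4 → Fin n) → Fin m × Fin m, Function.Injective ι →
        ((0 : Fin m), (0 : Fin m)) ∉ Set.range ι →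
        ¬ ∃ (P : ℕ → MvPolynomial (Fin m × Fin m) ℂ) (J : ℕ → Set (MvPolynomial (Fin m × Fin m) ℂ)),
          (∀ t : ℕ, P t ∈ glOrbit (Fin m × Fin m) ℂ (detPoly (Fin m) ℂ)) ∧
          IsBorderApolarLimit m P J ∧
          (∀ A : Matrix.GeneralLinearGroup (Fin m × Fin m) ℂ,
            let M : Matrix (Fin m × Fin m) (Fin m × Fin m) ℂ := A;
            (∃ a : Fin 4 → Matrix (Fin n) (Fin n) ℂ,
                (∀ (r : Fin 4) (i j : Fin n), j < i → a r i j = 0) ∧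
                (∀ I I' : Fin 4 → Fin n, M (ι I') (ι I) = ∏ r, a r (I' r) (I r)) ∧
                M (0, 0) (0, 0) ^ (m - n) * ∏ r, ∏ i, a r i i = 1) →
            (∀ (I : Fin 4 → Fin n) (p : Fin m × Fin m), p ∉ Set.range ι → M p (ι I) = 0) →
            (∀ p : Fin m × Fin m, p ≠ (0, 0) → M p (0, 0) = 0) →
            (∀ p q : Fin m × Fin m, p ∉ Set.range ι → p ≠ (0, 0) → q ∉ Set.range ι → q ≠ (0, 0) →
                (p.1 : ℕ) * m + (p.2 : ℕ) < (q.1 : ℕ) * m + (q.2 : ℕ) → M q p = 0) →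
            ∀ k ≤ m, ∀ D ∈ J k, linSubst (Fin m × Fin m) ℂ Mᵀ D ∈ J k) ∧
          (∀ k ≤ m, ∀ D ∈ J k, apolarAction D
            (X ((0 : Fin m), (0 : Fin m)) ^ (m - n) *
              rename ι (hyperdet fun I : Fin 4 → Fin n => (X I : MvPolynomial (Fin 4 → Fin n) ℂ))) = 0)) :
    ∀ c : ℕ, ∃ n₀ : ℕ, ∀ n ≥ n₀, ∀ (m : ℕ) [NeZero m], n ^ 2 + 1 ≤ m →
      m ≤ 2 ^ ((Nat.log 2 n + c) ^ c) →
      ∀ ι : (Fin 4 → Fin n) → Fin m × Fin m, Function.Injective ι →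
        ((0 : Fin m), (0 : Fin m)) ∉ Set.range ι →
        ¬ ∃ (P : ℕ → MvPolynomial (Fin m × Fin m) ℂ) (J : ℕ → Set (MvPolynomial (Fin m × Fin m) ℂ)),
          (∀ t : ℕ, P t ∈ glOrbit (Fin m × Fin m) ℂ (detPoly (Fin m) ℂ)) ∧
          IsBorderApolarLimit m P J ∧
          (∀ A : Matrix.GeneralLinearGroup (Fin m × Fin m) ℂ,
            let M : Matrix (Fin m × Fin m) (Fin m × Fin m) ℂ := A;
            (∃ a : Fin 4 → Matrix (Fin n) (Fin n) ℂ,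
                (∀ (r : Fin 4) (i j : Fin n), j < i → a r i j = 0) ∧
                (∀ I I' : Fin 4 → Fin n, M (ι I') (ι I) = ∏ r, a r (I' r) (I r)) ∧
                M (0, 0) (0, 0) ^ (m - n) * ∏ r, ∏ i, a r i i = 1) →
            (∀ (I : Fin 4 → Fin n) (p : Fin m × Fin m), p ∉ Set.range ι → M p (ι I) = 0) →
            (∀ p : Fin m × Fin m, p ≠ (0, 0) → M p (0, 0) = 0) →
            (∀ p q : Fin m × Fin m, p ∉ Set.range ι → p ≠ (0, 0) → q ∉ Set.range ι → q ≠ (0, 0) →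
                (p.1 : ℕ) * m + (p.2 : ℕ) < (q.1 : ℕ) * m + (q.2 : ℕ) → M q p = 0) →
            ∀ k ≤ m, ∀ D ∈ J k, linSubst (Fin m × Fin m) ℂ Mᵀ D ∈ J k) ∧
          (∀ k ≤ m, ∀ D ∈ J k, apolarAction D
            (X ((0 : Fin m), (0 : Fin m)) ^ (m - n) *
              rename ι (hyperdet fun I : Fin 4 → Fin n => (X I : MvPolynomial (Fin 4 → Fin n) ℂ))) = 0) := by
  intro c
  obtain ⟨n₀, hn₀⟩ := hC₂ c
  refine ⟨max n₀ 3, fun n hn m _ hm hmc ι hι hℓ hwit => ?_⟩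
  have hn3 : 3 ≤ n := le_of_max_le_right hn
  have hnm : n ≤ m := by nlinarith
  by_cases hlt : 2 * m < n ^ 4
  · -- polynomial part of the window: no membership at all (C₁), but a witness gives membership
    exact stub_borderFloor n m hn3 hnm hlt ι hι hℓ (hdc_mem_of_fixedWitness hnm ι hι hwit)
  · exact hn₀ n (le_of_max_le_left hn) m (not_lt.1 hlt) hmc ι hι hℓ hwit

/-- **C → C₂**: the whole-window statement restricts to the upper part (`n⁴ ≤ 2m` forces
`n² + 1 ≤ m` once `n ≥ 2`). -/
theorem hd_noFixedWitnessQP_high_of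
    (hC : ∀ c : ℕ, ∃ n₀ : ℕ, ∀ n ≥ n₀, ∀ (m : ℕ) [NeZero m], n ^ 2 + 1 ≤ m →
      m ≤ 2 ^ ((Nat.log 2 n + c) ^ c) →
      ∀ ι : (Fin 4 → Fin n) → Fin m × Fin m, Function.Injective ι →
        ((0 : Fin m), (0 : Fin m)) ∉ Set.range ι →
        ¬ ∃ (P : ℕ → MvPolynomial (Fin m × Fin m) ℂ) (J : ℕ → Set (MvPolynomial (Fin m × Fin m) ℂ)),
          (∀ t : ℕ, P t ∈ glOrbit (Fin m × Fin m) ℂ (detPoly (Fin m) ℂ)) ∧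
          IsBorderApolarLimit m P J ∧
          (∀ A : Matrix.GeneralLinearGroup (Fin m × Fin m) ℂ,
            let M : Matrix (Fin m × Fin m) (Fin m × Fin m) ℂ := A;
            (∃ a : Fin 4 → Matrix (Fin n) (Fin n) ℂ,
                (∀ (r : Fin 4) (i j : Fin n), j < i → a r i j = 0) ∧
                (∀ I I' : Fin 4 → Fin n, M (ι I') (ι I) = ∏ r, a r (I' r) (I r)) ∧
                M (0, 0) (0, 0) ^ (m - n) * ∏ r, ∏ i, a r i i = 1) →
            (∀ (I : Fin 4 → Fin n) (p : Fin m × Fin m), p ∉ Set.range ι → M p (ι I) = 0) →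
            (∀ p : Fin m × Fin m, p ≠ (0, 0) → M p (0, 0) = 0) →
            (∀ p q : Fin m × Fin m, p ∉ Set.range ι → p ≠ (0, 0) → q ∉ Set.range ι → q ≠ (0, 0) →
                (p.1 : ℕ) * m + (p.2 : ℕ) < (q.1 : ℕ) * m + (q.2 : ℕ) → M q p = 0) →
            ∀ k ≤ m, ∀ D ∈ J k, linSubst (Fin m × Fin m) ℂ Mᵀ D ∈ J k) ∧
          (∀ k ≤ m, ∀ D ∈ J k, apolarAction D
            (X ((0 : Fin m), (0 : Fin m)) ^ (m - n) *
              rename ι (hyperdet fun I : Fin 4 → Fin n => (X I : MvPolynomial (Fin 4 → Fin n) ℂ))) = 0)) :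
    ∀ c : ℕ, ∃ n₀ : ℕ, ∀ n ≥ n₀, ∀ (m : ℕ) [NeZero m], n ^ 4 ≤ 2 * m →
      m ≤ 2 ^ ((Nat.log 2 n + c) ^ c) →
      ∀ ι : (Fin 4 → Fin n) → Fin m × Fin m, Function.Injective ι →
        ((0 : Fin m), (0 : Fin m)) ∉ Set.range ι →
        ¬ ∃ (P : ℕ → MvPolynomial (Fin m × Fin m) ℂ) (J : ℕ → Set (MvPolynomial (Fin m × Fin m) ℂ)),
          (∀ t : ℕ, P t ∈ glOrbit (Fin m × Fin m) ℂ (detPoly (Fin m) ℂ)) ∧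
          IsBorderApolarLimit m P J ∧
          (∀ A : Matrix.GeneralLinearGroup (Fin m × Fin m) ℂ,
            let M : Matrix (Fin m × Fin m) (Fin m × Fin m) ℂ := A;
            (∃ a : Fin 4 → Matrix (Fin n) (Fin n) ℂ,
                (∀ (r : Fin 4) (i j : Fin n), j < i → a r i j = 0) ∧
                (∀ I I' : Fin 4 → Fin n, M (ι I') (ι I) = ∏ r, a r (I' r) (I r)) ∧
                M (0, 0) (0, 0) ^ (m - n) * ∏ r, ∏ i, a r i i = 1) →
            (∀ (I : Fin 4 → Fin n) (p : Fin m × Fin m), p ∉ Set.range ι → M p (ι I) = 0) →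
            (∀ p : Fin m × Fin m, p ≠ (0, 0) → M p (0, 0) = 0) →
            (∀ p q : Fin m × Fin m, p ∉ Set.range ι → p ≠ (0, 0) → q ∉ Set.range ι → q ≠ (0, 0) →
                (p.1 : ℕ) * m + (p.2 : ℕ) < (q.1 : ℕ) * m + (q.2 : ℕ) → M q p = 0) →
            ∀ k ≤ m, ∀ D ∈ J k, linSubst (Fin m × Fin m) ℂ Mᵀ D ∈ J k) ∧
          (∀ k ≤ m, ∀ D ∈ J k, apolarAction D
            (X ((0 : Fin m), (0 : Fin m)) ^ (m - n) *
              rename ι (hyperdet fun I : Fin 4 → Fin n => (X I : MvPolynomial (Fin 4 → Fin n) ℂ))) = 0) := by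
  intro c
  obtain ⟨n₀, hn₀⟩ := hC c
  refine ⟨max n₀ 2, fun n hn m _ hm hmc ι hι hℓ => ?_⟩
  exact hn₀ n (le_of_max_le_left hn) m (sq_succ_le_of_pow_four_le (le_of_max_le_right hn) hm)
    hmc ι hι hℓ

/-! ## Appended (lead c2): the registered bet is exactly crux stmt-ValiantsHypothesis-0323 -/

/-- **The registered bet C₂ (`stub_noFixedWitnessQP_high`, statement verbatim) is EQUIVALENT to
`GCTMult.GctThesis`** (crux stmt-ValiantsHypothesis-0323 of route GCTMult), unconditionally:
the line `four-dimensional-determinant` closes crux 0315 modulo exactly crux 0323. -/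
theorem hd_noFixedWitnessQP_high_iff_gctThesis :
    (∀ c : ℕ, ∃ n₀ : ℕ, ∀ n ≥ n₀, ∀ (m : ℕ) [NeZero m], n ^ 4 ≤ 2 * m →
      m ≤ 2 ^ ((Nat.log 2 n + c) ^ c) →
      ∀ ι : (Fin 4 → Fin n) → Fin m × Fin m, Function.Injective ι →
        ((0 : Fin m), (0 : Fin m)) ∉ Set.range ι →
        ¬ ∃ (P : ℕ → MvPolynomial (Fin m × Fin m) ℂ) (J : ℕ → Set (MvPolynomial (Fin m × Fin m) ℂ)),
          (∀ t : ℕ, P t ∈ glOrbit (Fin m × Fin m) ℂ (detPoly (Fin m) ℂ)) ∧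
          IsBorderApolarLimit m P J ∧
          (∀ A : Matrix.GeneralLinearGroup (Fin m × Fin m) ℂ,
            let M : Matrix (Fin m × Fin m) (Fin m × Fin m) ℂ := A;
            (∃ a : Fin 4 → Matrix (Fin n) (Fin n) ℂ,
                (∀ (r : Fin 4) (i j : Fin n), j < i → a r i j = 0) ∧
                (∀ I I' : Fin 4 → Fin n, M (ι I') (ι I) = ∏ r, a r (I' r) (I r)) ∧
                M (0, 0) (0, 0) ^ (m - n) * ∏ r, ∏ i, a r i i = 1) →
            (∀ (I : Fin 4 → Fin n) (p : Fin m × Fin m), p ∉ Set.range ι → M p (ι I) = 0) →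
            (∀ p : Fin m × Fin m, p ≠ (0, 0) → M p (0, 0) = 0) →
            (∀ p q : Fin m × Fin m, p ∉ Set.range ι → p ≠ (0, 0) → q ∉ Set.range ι → q ≠ (0, 0) →
                (p.1 : ℕ) * m + (p.2 : ℕ) < (q.1 : ℕ) * m + (q.2 : ℕ) → M q p = 0) →
            ∀ k ≤ m, ∀ D ∈ J k, linSubst (Fin m × Fin m) ℂ Mᵀ D ∈ J k) ∧
          (∀ k ≤ m, ∀ D ∈ J k, apolarAction D
            (X ((0 : Fin m), (0 : Fin m)) ^ (m - n) *
              rename ι (hyperdet fun I : Fin 4 → Fin n => (X I : MvPolynomial (Fin 4 → Fin n) ℂ))) = 0)) ↔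
    Summit.ValiantsHypothesis.ValiantsHypothesis.Theses.GCTMult.GctThesis :=
  ⟨fun hC₂ => hd_noFixedWitnessQP_iff_gctThesis.1 (hd_noFixedWitnessQP_of_high hC₂),
    fun hG => hd_noFixedWitnessQP_high_of (hd_noFixedWitnessQP_iff_gctThesis.2 hG)⟩

end Summit.ValiantsHypothesis.ValiantsHypothesis.Theorems.DetQPDetqpThesis.HdCalibration
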